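import Summits.Ventures.CertifiedManyBodySolver.Rows.TorusCeilingHomSpinTwistTTPrime
import Summits.Ventures.CertifiedManyBodySolver.Rows.TorusCeilingCoordSpinSeam
import HarnessLib

/-!
# Spin-twisted `t–t'` torus ceiling IV — seam form (the rows as computed) and the `L × L` carriers

HONEST FRAMING: first certified bounds; not a superconductivity verdict; every number certified or
labelled float.
(1) **The seam dictionary for the `t–t'` model.** For a bond table `A x i σ` on the `φ eᵢ`-hops the
INDUCED diagonal table `diagPathTable φ A` puts on the `φ j_s`-hop at `x` the product of the bond phases
along the path `x → x + φe₀ → x + φe₀ ± φe₁` (the exact-diagonalisation convention: a diagonal hop picks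
up every seam phase it crosses, `diagPathTable_coordSeam`). It is gauge-covariant
(`diagPathTable_homSpinGaugeTransform`) and for a uniform table it is the forced table `diagTwist`
(`diagPathTable_const`); hence the seam `t–t'` Hamiltonian
`homHubbardSpinMagTT'Gen φ (ĝ·κ) (diagPathTable φ (ĝ·κ))` and the spin-twisted `t–t'` torus
`homHubbardSpinMagTT' φ κ` have the same sector ground energies
(`minEnergyOn_szSector_homHubbardSpinMagTT'Gen_seam_gauge`).
(2) **The `L × L` carriers** (`(Int.castAddHom (ZMod L)).compLeft (Fin 2)`, `L ≥ 3`: non-degenerate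
nearest-neighbour AND diagonal hops, `injective_signedHop_coordHom_comp_diagMap`): every uniform spin twist
(`coordSpinTwistTT'_…`) and every seam table `η : Fin 2 → Fin 2 → U(1)` (`coordSpinSeamTT'_…`, the rows
`L×L_u<bx.by>_d<bx.by>_tp…` / `AP` / `PA` / `AA` of the CAL `t' ≠ 0` jobs) in every sector `(N↑, N↓)`,
density rows at the mean filling. Kernel item K8 of the CAL ceiling page (square carriers).
[cite: ShastrySutherland1990] [cite: Gros1992] [cite: Han2020Bootstrap, §3] [cite: XuEtAl2024, eq. (1)]
[cite: Lieb1994, eq. (1)]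
-/

noncomputable section

open Matrix Finset
open Literature.MathematicalPhysics.QuantumLattice
open Literature.MathematicalPhysics.QuantumFieldTheory hiding Site
open Literature.MathematicalPhysics.QuantumManyBody.StateRelaxation
open Literature.Probability.LatticeModels
open HubbardWave0
open scoped ComplexOrder ComplexConjugate

namespace Summit.Ventures.CertifiedManyBodySolver.Rows

/-! ### §1. The induced diagonal bond table and the seam dictionary -/

section DiagPath

variable {d' N : ℕ} [NeZero N] (φ : Site 2 →+ TorusSite d' N)

/-- **Induced diagonal bond table**: the phase of species `σ` on the `φ j_s`-hop leaving `x` is the product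
of the nearest-neighbour bond phases along `x → x + φe₀ → x + φe₀ + φe₁` (`s = 0`) resp.
`x → x + φe₀ → x + φe₀ − φe₁` (`s = 1`, the backward `e₁`-hop contributing the inverse phase) — a
diagonal hop picks up exactly the seam phases it crosses. [cite: Gros1992] [cite: XuEtAl2024, eq. (1)] -/
def diagPathTable (A : TorusSite d' N → Fin 2 → Fin 2 → Circle) :
    TorusSite d' N → Fin 2 → Fin 2 → Circle :=
  fun x s σ => A x 0 σ *
    (![A (x + φ (unitVec 0)) 1 σ, (A (x + φ (unitVec 0) - φ (unitVec 1)) 1 σ)⁻¹] : Fin 2 → Circle) s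

omit [NeZero N] in
/-- A uniform table induces the forced diagonal table `diagTwist κ` (`κ₀κ₁` on `j₀`, `κ₀κ₁⁻¹` on `j₁`).
[cite: ShastrySutherland1990] -/
theorem diagPathTable_const (κ : Fin 2 → Fin 2 → Circle) :
    diagPathTable φ (fun _ => κ) = fun _ => diagTwist κ := by
  funext x s σ
  fin_cases s
  · simp only [diagPathTable, Fin.zero_eta, Fin.isValue, Matrix.cons_val_zero]
    exact (diagTwist_zero κ σ).symm
  · simp only [diagPathTable, Fin.mk_one, Fin.isValue, Matrix.cons_val_one, Matrix.cons_val_fin_one]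
    exact (diagTwist_one κ σ).symm

omit [NeZero N] in
/-- **Gauge covariance of the induced diagonal table**: `diagPathTable (g·A) = g·(diagPathTable A)`, the
gauge acting on the diagonal graph `φ ∘ D`. [cite: Lieb1994, eq. (1)] -/
theorem diagPathTable_homSpinGaugeTransform (g : TorusSite d' N → Fin 2 → Circle)
    (A : TorusSite d' N → Fin 2 → Fin 2 → Circle) :
    diagPathTable φ (homSpinGaugeTransform φ g A) =
      homSpinGaugeTransform (φ.comp diagMap) g (diagPathTable φ A) := by
  funext x s σ
  have h0 : x + φ.comp diagMap (unitVec 0) = x + φ (unitVec 0) + φ (unitVec 1) := by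
    rw [comp_diagMap_unitVec, diagVec_zero_eq_add, map_add, add_assoc]
  have h1 : x + φ.comp diagMap (unitVec 1) = x + φ (unitVec 0) - φ (unitVec 1) := by
    rw [comp_diagMap_unitVec, diagVec_one_eq_sub, map_sub, add_sub_assoc]
  fin_cases s
  · simp only [diagPathTable, homSpinGaugeTransform, Fin.zero_eta, Fin.isValue, Matrix.cons_val_zero, h0]
    group
  · simp only [diagPathTable, homSpinGaugeTransform, Fin.mk_one, Fin.isValue, Matrix.cons_val_one,
      Matrix.cons_val_fin_one, h1, sub_add_cancel]
    group

/-- **Seam `t–t'` Hamiltonian = spin-twisted `t–t'` torus** in every sector: for a window/lattice gauge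
`ĝ` the seam tables `ĝ·κ` (nearest neighbours) and `diagPathTable φ (ĝ·κ)` (diagonals) give the same sector
ground energies as the uniform twist `κ`. [cite: Lieb1994, eq. (1)] [cite: ShastrySutherland1990] -/
theorem minEnergyOn_szSector_homHubbardSpinMagTT'Gen_seam_gauge (g : TorusSite d' N → Fin 2 → Circle)
    (κ : Fin 2 → Fin 2 → Circle) (t t' U : ℝ) (n : ℕ) (M : ℝ) :
    (homHubbardSpinMagTT'Gen φ (homSpinGaugeTransform φ g (fun _ => κ))
        (diagPathTable φ (homSpinGaugeTransform φ g (fun _ => κ))) t t' U).minEnergyOn (szSector n M) =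
      (homHubbardSpinMagTT' φ κ t t' U).minEnergyOn (szSector n M) := by
  rw [diagPathTable_homSpinGaugeTransform, diagPathTable_const,
    minEnergyOn_szSector_homHubbardSpinMagTT'Gen_homSpinGaugeTransform, homHubbardSpinMagTT']

end DiagPath

/-! ### §2. The `L × L` carriers: non-degenerate diagonal hops, every twist, every seam table -/

section Coord

variable {N : ℕ} [NeZero N]

omit [NeZero N] in
/-- The diagonal hops of the coordinate torus: `(coordHom ∘ D)(e_s) = j_s mod N`. [folklore] -/
theorem coordHom_comp_diagMap_unitVec (s : Fin 2) (j : Fin 2) :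
    ((Int.castAddHom (ZMod N)).compLeft (Fin 2)).comp diagMap (unitVec s) j = ((diagVec s j : ℤ) : ZMod N) := by
  rw [comp_diagMap_unitVec, coordHom_apply]

omit [NeZero N] in
/-- **Non-degenerate diagonal hops of the `N × N` torus**: for `N ≥ 3` the four signed diagonal hops
`±(1, 1), ±(1, −1) mod N` are pairwise distinct. [folklore] -/
theorem injective_signedHop_coordHom_comp_diagMap (hN : 3 ≤ N) :
    Function.Injective (signedHop (((Int.castAddHom (ZMod N)).compLeft (Fin 2)).comp diagMap)) := by
  have h1m : (1 : ZMod N) ≠ -1 := fun h => by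
    have h' : ((1 : ℤ) : ZMod N) = ((-1 : ℤ) : ZMod N) := by push_cast; exact h
    rw [ZMod.intCast_eq_intCast_iff_dvd_sub] at h'
    have h2 : (N : ℤ) ∣ 2 := by
      rw [show (-1 : ℤ) - 1 = -2 by norm_num, dvd_neg] at h'
      exact h'
    have := Int.le_of_dvd (by norm_num) h2
    omega
  have hv : ∀ (s : Fin 2) (b : Bool) (j : Fin 2),
      signedHop (((Int.castAddHom (ZMod N)).compLeft (Fin 2)).comp diagMap) (s, b) j =
        if b then ((diagVec s j : ℤ) : ZMod N) else -((diagVec s j : ℤ) : ZMod N) := by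
    intro s b j
    unfold signedHop
    cases b
    · simp only [cond_false, Pi.neg_apply, coordHom_comp_diagMap_unitVec, Bool.false_eq_true, if_false]
    · simp only [cond_true, coordHom_comp_diagMap_unitVec, if_true]
  have hne : (1 : Fin 2) ≠ 0 := by decide
  rintro ⟨s, b⟩ ⟨s', b'⟩ h
  have e0 := congrFun h 0
  have e1 := congrFun h 1
  rw [hv, hv] at e0 e1
  fin_cases s <;> fin_cases s' <;> cases b <;> cases b' <;>
    simp only [diagVec, Fin.zero_eta, Fin.mk_one, Fin.isValue, hne, Int.cast_one, Int.cast_neg, neg_neg,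
      if_true, Bool.false_eq_true, if_false] at e0 e1 ⊢ <;>
    first
    | rfl
    | exact absurd e0 h1m
    | exact absurd e0.symm h1m
    | exact absurd e1 h1m
    | exact absurd e1.symm h1m

/-- **Spin-twisted `L × L` `t–t'` torus, every twist, every sector `(N↑, N↓)`.** For `L ≥ 3`, a window `Λ'`
of coordinate spreads `≤ M` with `M + 1 ≤ L` containing all eight king-move neighbours of `Λ`
(`thicken Λ 1 ⊆ Λ'`) and `thicken {0} 1`, every translation + EOM `t–t'` window certificate bounds, for
EVERY spin-dependent boundary twist `κ : Fin 2 → Fin 2 → U(1)` (one phase per direction and species), the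
energy density of `homHubbardSpinMagTT' ((Int.castAddHom (ZMod L)).compLeft (Fin 2)) κ t t' U` in the sector
`(N↑, N↓) = (a, b)`: `c − Σ‖aₖ‖ + (Σ_σ μ_σ)((a + b)/(2L²) − ν) ≤ minEnergyOn H (szSector (a+b) ((a−b)/2)) / L²`.
[cite: ShastrySutherland1990] [cite: Han2020Bootstrap, §3] [cite: XuEtAl2024, eq. (1)] -/
theorem coordSpinTwistTT'_minEnergyOn_upDownSector_div_ge_of_window_certificate (L : ℕ) [NeZero L]
    (hL : 3 ≤ L) (t t' U : ℝ) (κt : Fin 2 → Fin 2 → Circle) {nu nd : ℕ}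
    (hnu : nu ≤ Fintype.card (FermionTorus 2 L)) (hnd : nd ≤ Fintype.card (FermionTorus 2 L))
    {Λ Λ' : Finset (Site 2)} (hΛ : Λ ⊆ Λ') {M : ℕ} (hM : M + 1 ≤ L)
    (hspread : ∀ x ∈ Λ', ∀ y ∈ Λ', ∀ i, |x i - y i| ≤ (M : ℤ))
    (h8 : thicken Λ 1 ⊆ Λ') (h0 : thicken ({0} : Finset (Site 2)) 1 ⊆ Λ') (hz : (0 : Site 2) ∈ Λ')
    (μ : Fin 2 → ℝ) (ν : ℝ)
    {m : Type*} [Fintype m] [DecidableEq m] {Λm : Matrix m m ℂ} (hΛm : Λm.PosSemidef)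
    (O : m → FermionOp Λ')
    {κ : Type*} (s : Finset κ) (B : κ → FermionOp Λ)
    {ι : Type*} (tt : Finset ι) (v : ι → Site 2) (hsh : ∀ l, shiftSet (v l) Λ ⊆ Λ') (Y : ι → FermionOp Λ)
    {γ : Type*} (u : Finset γ) (b : γ → ℂ) (cw : γ → List (Orb (PolySite Λ') × Bool))
    (hcw : ∀ j ∈ u, ladderCharge (cw j) ≠ 0 ∨ ladderSpinCharge (cw j) ≠ 0)
    {δ : Type*} (ah : Finset δ) (dc : δ → ℝ) (V : δ → FermionOp Λ')
    {κ'' : Type*} (w : Finset κ'') (a : κ'' → ℂ) (word : κ'' → List (Orb (PolySite Λ') × Bool)) {c : ℝ}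
    (hcert : fermionEmbed (PolySite.incl h0) ((hubbardTTPrimeFermionInteraction t t' U).meanEnergyObs 1) -
        (c : ℂ) • (1 : FermionOp Λ') -
        ∑ σ : Fin 2, ((μ σ : ℝ) : ℂ) • (nAt 0 hz σ - ((ν : ℝ) : ℂ) • (1 : FermionOp Λ')) =
      gramForm Λm O +
        (∑ k ∈ s, ((hubbardTTPrimeFermionInteraction t t' U).localHamiltonian Λ' * fermionEmbed (PolySite.incl hΛ) (B k) -
            fermionEmbed (PolySite.incl hΛ) (B k) * (hubbardTTPrimeFermionInteraction t t' U).localHamiltonian Λ') +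
          ∑ l ∈ tt, (fermionEmbed (PolySite.incl (hsh l)) (fermionEmbed (PolySite.shiftEmb (v l) Λ) (Y l)) -
            fermionEmbed (PolySite.incl hΛ) (Y l)) +
          ∑ j ∈ u, b j • ladderWord (cw j)) +
        (∑ m' ∈ ah, ((dc m' : ℝ) : ℂ) • ((V m')ᴴ - V m') + ∑ k ∈ w, a k • ladderWord (word k))) :
    c - ∑ k ∈ w, ‖a k‖ + (∑ σ : Fin 2, μ σ) * (((nu : ℝ) + nd) / 2 / (L : ℝ) ^ 2 - ν) ≤
      (homHubbardSpinMagTT' ((Int.castAddHom (ZMod L)).compLeft (Fin 2)) κt t t' U).minEnergyOn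
        (szSector (nu + nd) (((nu : ℝ) - nd) / 2)) / (L : ℝ) ^ 2 :=
  homTorusSpinTwistTT'_minEnergyOn_upDownSector_div_ge_of_window_certificate_avg
    ((Int.castAddHom (ZMod L)).compLeft (Fin 2)) t t' U κt (injective_signedHop_coordHom hL)
    (injective_signedHop_coordHom_comp_diagMap hL) hnu hnd hΛ h8 h0 hz (injOn_coordHom_of_spread hM hspread)
    μ ν hΛm O s B tt v hsh Y u b cw hcw ah dc V w a word hcert

/-- The seam table of exact diagonalisation on the coordinate torus: phase `η i σ` picked up by species
`σ` on the `i`-hops leaving the hyperplane `x_i = N − 1`. [cite: Gros1992] -/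
abbrev coordSeamTable (η : Fin 2 → Fin 2 → Circle) : TorusSite 2 N → Fin 2 → Fin 2 → Circle :=
  fun s i σ => if (s i).val = N - 1 then η i σ else 1

/-- **Spin-twisted `L × L` `t–t'` torus in SEAM form, every seam table, every sector** — the rows as
computed: nearest-neighbour seam table `coordSeamTable η` and the INDUCED diagonal table (a diagonal hop
picks up every seam phase it crosses). Same certificate data and conclusion as
`coordSpinTwistTT'_minEnergyOn_upDownSector_div_ge_of_window_certificate`.
[cite: ShastrySutherland1990] [cite: Gros1992] [cite: Han2020Bootstrap, §3] [cite: XuEtAl2024, eq. (1)] -/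
theorem coordSpinSeamTT'_minEnergyOn_upDownSector_div_ge_of_window_certificate (L : ℕ) [NeZero L]
    (hL : 3 ≤ L) (t t' U : ℝ) (η : Fin 2 → Fin 2 → Circle) {nu nd : ℕ}
    (hnu : nu ≤ Fintype.card (FermionTorus 2 L)) (hnd : nd ≤ Fintype.card (FermionTorus 2 L))
    {Λ Λ' : Finset (Site 2)} (hΛ : Λ ⊆ Λ') {M : ℕ} (hM : M + 1 ≤ L)
    (hspread : ∀ x ∈ Λ', ∀ y ∈ Λ', ∀ i, |x i - y i| ≤ (M : ℤ))
    (h8 : thicken Λ 1 ⊆ Λ') (h0 : thicken ({0} : Finset (Site 2)) 1 ⊆ Λ') (hz : (0 : Site 2) ∈ Λ')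
    (μ : Fin 2 → ℝ) (ν : ℝ)
    {m : Type*} [Fintype m] [DecidableEq m] {Λm : Matrix m m ℂ} (hΛm : Λm.PosSemidef)
    (O : m → FermionOp Λ')
    {κ : Type*} (s : Finset κ) (B : κ → FermionOp Λ)
    {ι : Type*} (tt : Finset ι) (v : ι → Site 2) (hsh : ∀ l, shiftSet (v l) Λ ⊆ Λ') (Y : ι → FermionOp Λ)
    {γ : Type*} (u : Finset γ) (b : γ → ℂ) (cw : γ → List (Orb (PolySite Λ') × Bool))
    (hcw : ∀ j ∈ u, ladderCharge (cw j) ≠ 0 ∨ ladderSpinCharge (cw j) ≠ 0)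
    {δ : Type*} (ah : Finset δ) (dc : δ → ℝ) (V : δ → FermionOp Λ')
    {κ'' : Type*} (w : Finset κ'') (a : κ'' → ℂ) (word : κ'' → List (Orb (PolySite Λ') × Bool)) {c : ℝ}
    (hcert : fermionEmbed (PolySite.incl h0) ((hubbardTTPrimeFermionInteraction t t' U).meanEnergyObs 1) -
        (c : ℂ) • (1 : FermionOp Λ') -
        ∑ σ : Fin 2, ((μ σ : ℝ) : ℂ) • (nAt 0 hz σ - ((ν : ℝ) : ℂ) • (1 : FermionOp Λ')) =
      gramForm Λm O +
        (∑ k ∈ s, ((hubbardTTPrimeFermionInteraction t t' U).localHamiltonian Λ' * fermionEmbed (PolySite.incl hΛ) (B k) -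
            fermionEmbed (PolySite.incl hΛ) (B k) * (hubbardTTPrimeFermionInteraction t t' U).localHamiltonian Λ') +
          ∑ l ∈ tt, (fermionEmbed (PolySite.incl (hsh l)) (fermionEmbed (PolySite.shiftEmb (v l) Λ) (Y l)) -
            fermionEmbed (PolySite.incl hΛ) (Y l)) +
          ∑ j ∈ u, b j • ladderWord (cw j)) +
        (∑ m' ∈ ah, ((dc m' : ℝ) : ℂ) • ((V m')ᴴ - V m') + ∑ k ∈ w, a k • ladderWord (word k))) :
    c - ∑ k ∈ w, ‖a k‖ + (∑ σ : Fin 2, μ σ) * (((nu : ℝ) + nd) / 2 / (L : ℝ) ^ 2 - ν) ≤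
      (homHubbardSpinMagTT'Gen ((Int.castAddHom (ZMod L)).compLeft (Fin 2)) (coordSeamTable η)
          (diagPathTable ((Int.castAddHom (ZMod L)).compLeft (Fin 2)) (coordSeamTable η)) t t' U).minEnergyOn
        (szSector (nu + nd) (((nu : ℝ) - nd) / 2)) / (L : ℝ) ^ 2 := by
  obtain ⟨κt, hκ⟩ := exists_pow_eq_circle_spinTable η (NeZero.ne L)
  have hseam : coordSeamTable (N := L) η =
      homSpinGaugeTransform ((Int.castAddHom (ZMod L)).compLeft (Fin 2)) (fun s σ => ∏ j, κt j σ ^ (s j).val)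
        (fun _ => κt) := by
    rw [homSpinGaugeTransform_coordGauge]
    funext s i σ
    simp only [coordSeamTable, hκ]
  rw [hseam, minEnergyOn_szSector_homHubbardSpinMagTT'Gen_seam_gauge]
  exact coordSpinTwistTT'_minEnergyOn_upDownSector_div_ge_of_window_certificate L hL t t' U κt hnu hnd hΛ hM
    hspread h8 h0 hz μ ν hΛm O s B tt v hsh Y u b cw hcw ah dc V w a word hcert

/-- **Reading of the induced diagonal table on the coordinate torus** (the exact-diagonalisation rule): the
`j₀ = (1, 1)`-hop leaving `x` carries `[x₀ = N−1] η₀ · [x₁ = N−1] η₁` and the `j₁ = (1, −1)`-hop carries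
`[x₀ = N−1] η₀ · ([x₁ = 0] η₁)⁻¹` (Iverson brackets; `N ≥ 2`). [cite: Gros1992] -/
theorem diagPathTable_coordSeam (hN : 2 ≤ N) (η : Fin 2 → Fin 2 → Circle) (x : TorusSite 2 N) (σ : Fin 2) :
    diagPathTable ((Int.castAddHom (ZMod N)).compLeft (Fin 2)) (coordSeamTable η) x 0 σ =
        (if (x 0).val = N - 1 then η 0 σ else 1) * (if (x 1).val = N - 1 then η 1 σ else 1) ∧
      diagPathTable ((Int.castAddHom (ZMod N)).compLeft (Fin 2)) (coordSeamTable η) x 1 σ =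
        (if (x 0).val = N - 1 then η 0 σ else 1) * (if (x 1).val = 0 then η 1 σ else 1)⁻¹ := by
  have h01 : ((x + (Int.castAddHom (ZMod N)).compLeft (Fin 2) (unitVec 0)) 1).val = (x 1).val := by
    rw [val_add_coordHom_unitVec, if_neg one_ne_zero]
  have h1 : ((x + (Int.castAddHom (ZMod N)).compLeft (Fin 2) (unitVec 0) -
      (Int.castAddHom (ZMod N)).compLeft (Fin 2) (unitVec 1)) 1).val = N - 1 ↔ (x 1).val = 0 := by
    rw [Pi.sub_apply, Pi.add_apply, coordHom_unitVec, coordHom_unitVec, Pi.single_eq_of_ne one_ne_zero, add_zero,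
      Pi.single_eq_same]
    constructor
    · intro h
      have h2 : x 1 = (x 1 - 1) + 1 := (sub_add_cancel _ _).symm
      have h3 : (x 1).val = ((x 1 - 1) + 1 : ZMod N).val := congrArg ZMod.val h2
      rw [ZMod.val_add, h, ZMod.val_one_eq_one_mod, Nat.add_mod_mod, show N - 1 + 1 = N by omega,
        Nat.mod_self] at h3
      exact h3
    · intro h
      have hx : x 1 = 0 := (ZMod.val_eq_zero _).1 h
      rw [hx, zero_sub, ZMod.neg_val', ZMod.val_one_eq_one_mod, Nat.mod_eq_of_lt (by omega : 1 < N),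
        Nat.mod_eq_of_lt (by omega : N - 1 < N)]
  refine ⟨?_, ?_⟩
  · simp only [diagPathTable, coordSeamTable, Fin.isValue, Matrix.cons_val_zero, h01]
  · simp only [diagPathTable, coordSeamTable, Fin.isValue, Matrix.cons_val_one, Matrix.cons_val_fin_one]
    by_cases h : (x 1).val = 0
    · rw [if_pos (h1.2 h), if_pos h]
    · rw [if_neg (fun h' => h (h1.1 h')), if_neg h]

end Coord

end Summit.Ventures.CertifiedManyBodySolver.Rows

end
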